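import Mathlib.NumberTheory.NumberField.Cyclotomic.Ideal
import Mathlib.NumberTheory.NumberField.Cyclotomic.Basic
import HarnessLib

/-!
# Bounded decomposition in the `2`-power cyclotomic tower: a rational prime has at most `ℓ²` (odd `ℓ`) resp. `1` (`ℓ = 2`) primes
# above it in `ℚ(ζ_{2^{k+2}})`, uniformly in `k` — and hence in every subfield

Topic `NumberTheory/NumberFields` (namespace = path).  THEOREM-ONLY file (no definition, no named fact, no instance, no `sorry`),
written by the prover seat `bsd-2adic-conv-1` GEN 33 (cell `bsd-2adic`; pen RC-450 key «FW-IQ-GENUS», input (L5): the number of primes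
of the `n`-th layer `ℚ_n = ℚ(ζ_{2^{n+2}})⁺` of the cyclotomic `ℤ₂`-extension of `ℚ` above a fixed rational prime is bounded
independently of `n` — «every prime is finitely decomposed in `ℚ_∞`»).

* §1 `two_pow_dvd_mul_of_dvd_pow_two_pow_sub_one` — elementary `2`-adic lifting: for odd `ℓ`, `2^m ∣ ℓ^{2^a} − 1 ⟹ 2^m ∣ (ℓ² − 1)·2^a`
  (`v₂(ℓ^{2^a} − 1) = v₂(ℓ² − 1) + a − 1` for `a ≥ 1`).
* §2 `ncard_primesOver_le_sq_of_isCyclotomicExtension_two_pow` — for `N = ℚ(ζ_{2^{k+2}})` and an odd prime `ℓ`: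
  `#{𝔔 ∣ ℓ} ≤ ℓ²`.  Mathlib: `ℓ` is unramified in `N` with residue degree `f = ord(ℓ mod 2^{k+2})`
  (`IsCyclotomicExtension.Rat.inertiaDegIn_eq_of_not_dvd`), `g·e·f = 2^{k+1}`; `f` is a power of `2` with `2^{k+2} ∣ ℓ^f − 1`, so
  `2^{k+2} ∣ (ℓ² − 1)·f` by §1 and `2g ≤ ℓ² − 1`.  `ncard_primesOver_two_eq_one_of_isCyclotomicExtension_two_pow` — `ℓ = 2`: exactly one
  prime (Mathlib `ncard_primesOver_of_prime_pow`).
* §3 `ncard_primesOver_le_of_algebra` — going DOWN: for number fields `F → E`, every prime of `F` above `ℓ` lies under a prime of `E` above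
  `ℓ`, so `#{v ∣ ℓ in F} ≤ #{𝔔 ∣ ℓ in E}`; `ncard_primesOver_le_sq_of_algebra_isCyclotomicExtension_two_pow` — the uniform bound for every
  subfield of `ℚ(ζ_{2^{k+2}})` (e.g. `ℚ(ζ_{2^{k+2}})⁺`).

HONEST SCOPE: elementary; the sharp count `2^{v₂(ℓ²−1)−2}` (resp. the exact decomposition field) is not needed and not proved.
Nothing here is specific to any summit; BSD is not proved by any of this.

## References
* L. C. Washington, *Introduction to Cyclotomic Fields* (1997), Thm. 2.13 (splitting of primes in `ℚ(ζ_m)`: `f = ord(p mod m)`),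
  §13.1 (finitely many primes of `ℚ_∞` above each prime). [Washington1997]
* J. Neukirch, *Algebraic Number Theory* (1999), Ch. I §8 (fundamental identity), §9. [NeukirchANT1999]
-/

set_option autoImplicit false

noncomputable section

open NumberField IsDedekindDomain Ideal

namespace Literature.NumberTheory.NumberFields

/-! ## §1 `2`-adic lifting for `ℓ^{2^a} − 1` -/

/-- For odd `x`: `x² + 1 ≡ 2 (mod 4)`, so `x^{2} + 1 = 2·u` with `u` odd; here in the form `2 ∣ x² + 1 ∧ ¬ 4 ∣ x² + 1`. [folklore] -/
private theorem two_dvd_sq_add_one_not_four (x : ℕ) (hx : Odd x) : 2 ∣ x ^ 2 + 1 ∧ ¬ 4 ∣ x ^ 2 + 1 := by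
  obtain ⟨t, rfl⟩ := hx
  constructor
  · exact ⟨2 * t ^ 2 + 2 * t + 1, by ring⟩
  · intro h
    have : (2 * t + 1) ^ 2 + 1 = 4 * (t ^ 2 + t) + 2 := by ring
    omega

/-- **`2^m ∣ ℓ^{2^a} − 1 ⟹ 2^m ∣ (ℓ² − 1)·2^a`** for odd `ℓ` (the `2`-adic valuation of `ℓ^{2^a} − 1` is `v₂(ℓ² − 1) + a − 1` for
`a ≥ 1` and `v₂(ℓ − 1) ≤ v₂(ℓ² − 1)` for `a = 0`). [cite: Washington1997, §13.1 (the primes of `ℚ_∞` above `ℓ`)] -/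
theorem two_pow_dvd_mul_of_dvd_pow_two_pow_sub_one (ℓ : ℕ) (hℓ : Odd ℓ) :
    ∀ a m : ℕ, 2 ^ m ∣ ℓ ^ (2 ^ a) - 1 → 2 ^ m ∣ (ℓ ^ 2 - 1) * 2 ^ a := by
  have hℓ1 : 1 ≤ ℓ := hℓ.pos
  intro a
  induction a with
  | zero =>
    intro m h
    rw [pow_zero, pow_one] at h
    rw [pow_zero, mul_one]
    have hfac : ℓ ^ 2 - 1 = (ℓ - 1) * (ℓ + 1) := by
      have h1 : 1 ≤ ℓ ^ 2 := Nat.one_le_pow _ _ hℓ.pos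
      zify [h1, hℓ1]
      ring
    rw [hfac]
    exact Dvd.dvd.mul_right h _
  | succ a ih =>
    intro m h
    rcases Nat.eq_zero_or_pos a with ha | ha
    · -- `a = 0`: `ℓ^{2} − 1 ∣ (ℓ² − 1)·2`
      subst ha
      rw [zero_add, pow_one] at h
      exact Dvd.dvd.mul_right h _
    · -- `a ≥ 1`: `ℓ^{2^{a+1}} − 1 = (ℓ^{2^a} − 1)(ℓ^{2^a} + 1)`, second factor `= 2·odd`
      set x := ℓ ^ (2 ^ a) with hx
      have hx1 : 1 ≤ x := Nat.one_le_pow _ _ hℓ1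
      have hfac : ℓ ^ (2 ^ (a + 1)) - 1 = (x - 1) * (x + 1) := by
        have h1 : ℓ ^ (2 ^ (a + 1)) = x ^ 2 := by rw [hx, ← pow_mul, pow_succ]
        rw [h1]
        have h2 : 1 ≤ x ^ 2 := Nat.one_le_pow _ _ (by omega)
        zify [h2, hx1]
        ring
      rw [hfac] at h
      -- `x = y²` with `y` odd, so `x + 1 = 2 u`, `u` odd
      obtain ⟨b, hb⟩ : ∃ b, a = b + 1 := ⟨a - 1, by omega⟩
      have hxsq : x = (ℓ ^ (2 ^ b)) ^ 2 := by rw [hx, hb, pow_succ, pow_mul]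
      have hyodd : Odd (ℓ ^ (2 ^ b)) := hℓ.pow
      obtain ⟨h2, h4⟩ := two_dvd_sq_add_one_not_four (ℓ ^ (2 ^ b)) hyodd
      rw [← hxsq] at h2 h4
      obtain ⟨u, hu⟩ := h2
      have huodd : ¬ 2 ∣ u := by
        rintro ⟨w, rfl⟩; exact h4 ⟨w, by rw [hu]; ring⟩
      rw [hu] at h
      -- `2^m ∣ (x - 1) * (2 * u)`, `u` odd ⇒ `2^m ∣ (x - 1) * 2`
      have hcop : Nat.Coprime (2 ^ m) u := (Nat.prime_two.coprime_iff_not_dvd.mpr huodd).pow_left m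
      have h' : 2 ^ m ∣ (x - 1) * 2 := by
        have : (x - 1) * (2 * u) = ((x - 1) * 2) * u := by ring
        rw [this] at h
        exact hcop.dvd_of_dvd_mul_right h
      -- peel one factor of `2` and apply the induction hypothesis
      cases m with
      | zero => exact one_dvd _
      | succ m =>
        have h'' : 2 ^ m ∣ x - 1 := by
          rw [pow_succ] at h'
          exact Nat.dvd_of_mul_dvd_mul_right two_pos h'
        have hih := ih m h''
        rw [pow_succ 2 m, pow_succ 2 a, ← mul_assoc]
        exact Nat.mul_dvd_mul hih (dvd_refl 2)

/-! ## §2 Primes above `ℓ` in `ℚ(ζ_{2^{k+2}})` -/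

section Cyclotomic

variable (N : Type) [Field N] [NumberField N] (k : ℕ) [hN : IsCyclotomicExtension {2 ^ (k + 2)} ℚ N]

include hN in
/-- **An odd prime `ℓ` has at most `ℓ²` primes above it in `ℚ(ζ_{2^{k+2}})`, for every `k`.**  `ℓ` is unramified with residue
degree `f = ord(ℓ mod 2^{k+2})` (Mathlib), `g·f = 2^{k+1}`, `f` a power of `2` with `2^{k+2} ∣ ℓ^f − 1 ∣`-wise `(ℓ²−1)·f` (§1), whence
`2g ≤ ℓ² − 1`. [cite: Washington1997, Thm. 2.13 and §13.1] -/
theorem ncard_primesOver_le_sq_of_isCyclotomicExtension_two_pow {ℓ : ℕ} (hℓ : ℓ.Prime) (hℓ2 : ℓ ≠ 2) :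
    ((Ideal.span {(ℓ : ℤ)}).primesOver (𝓞 N)).ncard ≤ ℓ ^ 2 := by
  classical
  haveI : Fact ℓ.Prime := ⟨hℓ⟩
  haveI : NeZero (2 ^ (k + 2)) := ⟨pow_ne_zero _ two_ne_zero⟩
  haveI : IsGalois ℚ N := IsCyclotomicExtension.isGalois {2 ^ (k + 2)} ℚ N
  have hodd : Odd ℓ := hℓ.odd_of_ne_two hℓ2
  have hndvd : ¬ ℓ ∣ 2 ^ (k + 2) := fun h =>
    hℓ2 ((Nat.prime_dvd_prime_iff_eq hℓ Nat.prime_two).mp (hℓ.dvd_of_dvd_pow h))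
  -- fundamental identity with `e = 1`, `f = ord(ℓ mod 2^{k+2})`
  have hfund := Ideal.ncard_primesOver_mul_ramificationIdxIn_mul_inertiaDegIn (Ideal.span {(ℓ : ℤ)}) (𝓞 N) (N ≃ₐ[ℚ] N)
  rw [IsCyclotomicExtension.Rat.ramificationIdxIn_eq_of_not_dvd ℓ N hndvd,
    IsCyclotomicExtension.Rat.inertiaDegIn_eq_of_not_dvd ℓ N hndvd, one_mul,
    IsGaloisGroup.card_eq_finrank (N ≃ₐ[ℚ] N) ℚ N, IsCyclotomicExtension.Rat.finrank (2 ^ (k + 2)) N,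
    show k + 2 = (k + 1) + 1 by ring, Nat.totient_prime_pow_succ Nat.prime_two] at hfund
  norm_num at hfund
  -- `hfund : g * orderOf (ℓ : ZMod 2^{k+2}) = 2 ^ (k + 1)`
  set f := orderOf ((ℓ : ℕ) : ZMod (2 ^ (k + 1 + 1))) with hf
  set g := ((Ideal.span {(ℓ : ℤ)}).primesOver (𝓞 N)).ncard with hg
  -- `f` is a power of `2`
  have hfdvd : f ∣ 2 ^ (k + 1) := ⟨g, by rw [mul_comm]; exact hfund.symm⟩
  obtain ⟨a, -, hfa⟩ := (Nat.dvd_prime_pow Nat.prime_two).mp hfdvd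
  -- `2^{k+2} ∣ ℓ^f − 1`
  have hpow : ((ℓ : ℕ) : ZMod (2 ^ (k + 1 + 1))) ^ f = 1 := pow_orderOf_eq_one _
  have hdvd : 2 ^ (k + 1 + 1) ∣ ℓ ^ f - 1 := by
    have h1 : 1 ≤ ℓ ^ f := Nat.one_le_pow _ _ hℓ.pos
    rw [← ZMod.natCast_eq_zero_iff, Nat.cast_sub h1, Nat.cast_pow, Nat.cast_one, hpow, sub_self]
  rw [hfa] at hdvd
  have hle := Nat.le_of_dvd (Nat.mul_pos (by
      have : 2 ^ 2 ≤ ℓ ^ 2 := Nat.pow_le_pow_left hℓ.two_le 2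
      omega) (pow_pos two_pos a))
    (two_pow_dvd_mul_of_dvd_pow_two_pow_sub_one ℓ hodd a (k + 1 + 1) hdvd)
  -- `g * 2^a = 2^{k+1}` and `2^{k+2} ≤ (ℓ²−1) 2^a` ⇒ `2 g ≤ ℓ² − 1`
  rw [hfa] at hfund
  have h2 : 2 * g * 2 ^ a ≤ (ℓ ^ 2 - 1) * 2 ^ a := by
    calc 2 * g * 2 ^ a = 2 ^ (k + 1 + 1) := by rw [mul_assoc, hfund]; ring
      _ ≤ (ℓ ^ 2 - 1) * 2 ^ a := hle
  have h3 : 2 * g ≤ ℓ ^ 2 - 1 := Nat.le_of_mul_le_mul_right h2 (pow_pos two_pos a)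
  omega

include hN in
/-- **`ℚ(ζ_{2^{k+2}})` has exactly one prime above `2`** (`(ζ − 1)`, totally ramified; Mathlib). [cite: Washington1997, Prop. 2.1] -/
theorem ncard_primesOver_two_eq_one_of_isCyclotomicExtension_two_pow :
    ((Ideal.span {((2 : ℕ) : ℤ)}).primesOver (𝓞 N)).ncard = 1 := by
  haveI : Fact (Nat.Prime 2) := ⟨Nat.prime_two⟩
  haveI : IsCyclotomicExtension {2 ^ (k + 1 + 1)} ℚ N := by
    rw [show k + 1 + 1 = k + 2 by ring]; exact hN
  exact IsCyclotomicExtension.Rat.ncard_primesOver_of_prime_pow 2 (k + 1) N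

end Cyclotomic

/-! ## §3 Going down to a subfield -/

/-- **The number of primes above `ℓ` does not increase when passing to a subfield**: for number fields `F → E`, every prime of `F`
above the rational prime `ℓ` lies under some prime of `E` above `ℓ` (going up), and distinct primes of `F` have distinct such
witnesses' restrictions. [cite: NeukirchANT1999, Ch. I §9 (9.1)] -/
theorem ncard_primesOver_le_of_algebra (F E : Type*) [Field F] [NumberField F] [Field E] [NumberField E] [Algebra F E]
    {ℓ : ℕ} (hℓ : ℓ.Prime) :
    ((Ideal.span {(ℓ : ℤ)}).primesOver (𝓞 F)).ncard ≤ ((Ideal.span {(ℓ : ℤ)}).primesOver (𝓞 E)).ncard := by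
  classical
  haveI : Fact ℓ.Prime := ⟨hℓ⟩
  haveI : (Ideal.span {(ℓ : ℤ)}).IsMaximal := Int.ideal_span_isMaximal_of_prime ℓ
  -- the restriction `𝔔 ↦ 𝔔 ∩ 𝓞 F` maps `primesOver ℓ (𝓞 E)` ONTO `primesOver ℓ (𝓞 F)`
  have hsub : (Ideal.span {(ℓ : ℤ)}).primesOver (𝓞 F) ⊆
      (fun 𝔔 : Ideal (𝓞 E) => 𝔔.under (𝓞 F)) '' (Ideal.span {(ℓ : ℤ)}).primesOver (𝓞 E) := by
    intro P hP
    haveI := hP.1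
    haveI := hP.2
    obtain ⟨⟨Q, hQ, hQP⟩⟩ := P.nonempty_primesOver (S := 𝓞 E)
    haveI := hQ
    haveI := hQP
    refine ⟨Q, ⟨hQ, Ideal.LiesOver.trans Q P (Ideal.span {(ℓ : ℤ)})⟩, hQP.over.symm⟩
  refine le_trans (Set.ncard_le_ncard hsub (Set.Finite.image _ ?_)) (Set.ncard_image_le ?_)
  · exact IsDedekindDomain.primesOver_finite _ _
  · exact IsDedekindDomain.primesOver_finite _ _

/-- **Uniform bound in every subfield of `ℚ(ζ_{2^{k+2}})`** (e.g. `ℚ(ζ_{2^{k+2}})⁺ = ℚ_k`): a rational prime `ℓ` has at most `ℓ²`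
primes above it, for EVERY `k`. [cite: Washington1997, §13.1] -/
theorem ncard_primesOver_le_sq_of_algebra_isCyclotomicExtension_two_pow
    (N : Type) [Field N] [NumberField N] (k : ℕ) [IsCyclotomicExtension {2 ^ (k + 2)} ℚ N]
    (F : Type) [Field F] [NumberField F] [Algebra F N] {ℓ : ℕ} (hℓ : ℓ.Prime) :
    ((Ideal.span {(ℓ : ℤ)}).primesOver (𝓞 F)).ncard ≤ ℓ ^ 2 := by
  refine le_trans (ncard_primesOver_le_of_algebra F N hℓ) ?_
  rcases eq_or_ne ℓ 2 with rfl | hℓ2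
  · rw [ncard_primesOver_two_eq_one_of_isCyclotomicExtension_two_pow N k]; norm_num
  · exact ncard_primesOver_le_sq_of_isCyclotomicExtension_two_pow N k hℓ hℓ2

end Literature.NumberTheory.NumberFields

end
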